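import Summits.SmoothPoincare4.SmoothPoincare4.Theorems.SullivanDualTargetOfSympcap
import Summits.SmoothPoincare4.SmoothPoincare4.Theorems.SullivanDualTargetStubStandardEnd
import Summits.SmoothPoincare4.SmoothPoincare4.Theorems.SullivanDualTargetStubBallExtension
import Summits.SmoothPoincare4.SmoothPoincare4.Theorems.SullivanDualTargetStubLiouvilleCollar

/-!
# Line `kaehler-jacket` — skeleton for crux `SullivanDual.Target` (stmt-SmoothPoincare4-7823)
# v2 (lead c6, 2026-08-17): `stub_standardEnd` PROVED (p132182); sub-goals of `stub_ballExtension` LANDED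
# (helper_slowStep p132250, helper_formGlue p132272, helper_collarFirstOrder p132336, helper_kjRadialInverse p132421,
# helper_radialModel p132477, helper_collarInterpolation p132634, helper_kjCollarMap p132572).
# v3 (lead c6, 2026-08-17): `stub_ballExtension` PROVED (p133004).
# v4 (lead c6, 2026-08-17T01:45Z): `stub_liouvilleCollar` PROVED (p135853) — the skeleton is CLOSED MODULO ITS APEX
# `stub_tightInnerSphere` (1 sorry), which is kernel-certified ≡ the crux mod GromovChartForm (StarJacketAt certificate p135233;
# v1-apex certificates: …TightInnerSphereCertificate / starJacketAt_of_tightInnerSphereAt).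

Route `route-SmoothPoincare4-SullivanDual`; idea card `Cruxes/Target/Ideas/kaehler-jacket.md`
(crux-ideate r1, ideator 1); triage r1-1/2/3: pass ×3 (sharpenings: state the orientation
conventions — `ι` is orientation-reversing, `S_μ(q)` is the CONCAVE end of the exact piece
`W ∖ B_μ(q)`; carry the fillable variant K1′; first worker target = the `S⁴` model). Planner
`planner-cruxplan-stmt-SmoothPoincare4-7823-kaehler-jacket-0`, 2026-08-16.

Crux (FIXED, never restated): `Target` — for every homotopy 4-sphere `Σ` and `p ∈ Σ` some smooth
`J` with `J² = -1` on `Σ ∖ p` has no taming witness (W1)–(W3) at all small radii.  Entry door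
used: `SullivanDual.target_of_sympcapThesisV2` (landed p119400, Theorems/SullivanDualTargetOfSympcap):
ONE `2`-form per `(Σ, p)` that is symplectic and standard near `p`
(`IsSymplecticStandardNearPoint`) gives `Target` (the `sf`-compatible `J` is tamed by a closed
form standard on the ball, which kills every witness).

## The line: the KÄHLER JACKET

Immerse `W ∖ q` (`W := Σ ∖ p`, `q ≠ p`) in `ℂ² = ℝ⁴` by a jacket `F` which EQUALS the inverted chart
`ι ∘ (e_p − e_p p)` near `p` (relative Hirsch–Poénaru h-principle: the free end at `q` makes it
applicable; all data are then pulled back from `(ℂ², i, ω₀)`): `ω_F := F*ω₀` is an exact symplectic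
form on `W ∖ q`, standard near `p`.  Everything exotic about `Σ` now sits in the germ of `ω_F` along
one small chart-sphere `S_μ(q)` around `q`.  The line closes the crux iff that inner sphere can be
chosen ω_F-CONVEX FROM THE q-SIDE (contact type, Liouville field pointing away from `q`) with TIGHT
(= standard) characteristic contact structure: then the q-side germ is the germ of a star-shaped
hypersurface of `(ℂ², ω₀)` (Liouville collar lemma, Geiges 2008 Lemma 5.2.4), the star-shaped
4-ball caps the puncture `q` inside `W` itself (no regluing, no Cerf, no Gromov recognition), and
the capped form is symplectic on `Σ ∖ p` and standard near `p` — the door.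

Stubs (all four consumed BY NAME by the composition `Target_of`; sizes are guesses):

* `stub_tightInnerSphere` — THE APEX (conjecture-grade; equivalent to SPC4(Σ); true for `Σ ≅ S⁴`
  with `F` a diffeomorphism onto `ℝ⁴` normalised by Palais' disc theorem near `q`).  For every
  `(Σ, p)` there are `q ≠ p`, a jacket `F`, a chart-sphere `S_μ(q)` bounding a chart-ball in
  `Σ ∖ p`, a smooth `1`-form `α` with `dα = ω_F` on a shell around `S_μ(q)` whose `ω_F`-dual
  (Liouville) field `Z` points AWAY from `q` along `S_μ(q)` (contact type, `S_μ(q)` concave end of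
  `W ∖ B_μ(q)` — triage r1-1/2/3), and whose restriction to `S_μ(q)` is, in the chart
  parametrisation `θ ↦ e_q⁻¹(e_q q + μ A θ)` of `S_μ(q)` by the unit sphere (`A ∈ O(4)` fixed),
  the POSITIVE multiple `e^{u} α₀` of the standard contact form `α₀ = ½ ω₀(θ, ·)` (tight = standard:
  Eliashberg's uniqueness of the tight structure on `S³` and his contact-isotopy lemma are absorbed
  here, by reparametrising the jacket — see the card, "T-ext").
* `stub_liouvilleCollar` (M; Geiges 2008 Lemma 5.2.4 + `(θ ↦ ρθ)*λ₀ = ρ² α₀`): the data of the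
  apex give a symplectic EMBEDDING `Ψ` of a shell around `S_μ(q)` into `(ℝ⁴, ω₀)` (`Ψ*ω₀ = F*ω₀`)
  carrying `S_μ(q)` onto the star-shaped hypersurface `{e^{u(θ)/2} θ}` and the q-side into its
  inside (match the Liouville flows of `Z` and of `½ r ∂_r`).
* `stub_ballExtension` (M–L; Geiges 2008 Lemma 1.7.2-type radial extension + piecewise form):
  extend `Ψ` from an inner collar over the closed chart-ball `B̄_μ(q)` as a diffeomorphism onto the
  closed star-shaped domain and pull `ω₀` back: a smooth closed non-degenerate `2`-form `sf` on
  `Σ ∖ p` equal to `F*ω₀` off `B̄_μ(q)`.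
* `stub_standardEnd` (S–M; chain rule for `F = ι ∘ (e_p − e_p p)` + a radius avoiding the compact
  cap): such an `sf` is `IsSymplecticStandardNearPoint p ε sf` for some `ε`.

Composition `Target_of` (sorry-free): apex → collar → ball extension → standard end → door.

Disproof.lean: none exists for this crux (payload `disproof_path` absent, `Cruxes/Target/Disproof.lean`
absent, `ledger negatives --problem SmoothPoincare4` = 0, 2026-08-16T21:30Z); no landed
`Theorems/Target/Negative/*`.  Nothing to honour or import; no stub restates `Target`, item 0518
(`SympcapThesisV2`) or the summit: the apex is a statement about one immersed `3`-sphere and one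
`1`-form, the two middle stubs are printed lemmas, the last is calculus.
-/

noncomputable section

-- the prescribed namespace `Summit.<P>.<Sub>.…` duplicates `SmoothPoincare4` (P = Sub)
set_option linter.dupNamespace false

open scoped Manifold ContDiff Topology
open Set Function
open Literature.Geometry.Kaehler (MForm IsSmoothForm IsClosedForm mextDeriv)
open Literature.Geometry.Symplectic (punctured InPuncturedChartBall stdSymplecticForm inversion
  invertedStdForm IsSymplecticStandardNearPoint AgreesWithInvertedChartNear)
open Literature.Topology.FourManifolds (HomotopySphere)

namespace Summit.SmoothPoincare4.SmoothPoincare4.Cruxes.Target.KaehlerJacket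

/-- Model space `ℝ⁴ = ℂ²` (`z₁ = x₀ + i x₁`, `z₂ = x₂ + i x₃`; `ω₀ = stdSymplecticForm`,
`⟪i a, b⟫ = ω₀(a, b)`). -/
local notation "E4" => EuclideanSpace ℝ (Fin 4)

/-! ## Registered stubs -/

/-- **Stub 1 — APEX: a jacket with a TIGHT, ω_F-CONVEX-FROM-q inner sphere ("TIS", T-ext form).**
For every homotopy 4-sphere `Σ` and `p ∈ Σ` there are: a point `q ≠ p`; a JACKET `F : Σ ∖ p → ℝ⁴`
— `C^∞` with injective differential at every point other than `q`, and equal to the inverted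
recentred chart `ι ∘ (e_p − e_p p)` on a punctured chart-ball at `p`
(`AgreesWithInvertedChartNear`); radii `0 < μ < μ'` such that the closed chart-ball of radius `μ'`
about `q` (chart `e_q = extChartAt q`, centre `c = e_q q`) lies in the chart and misses `p`; a
smooth `1`-form `α` on `Σ ∖ p` and a width `δ > 0` such that on the shell
`|‖e_q x − c‖ − μ| < δ`: (PRIM) `dα = F*ω₀`, (DUAL) the field `Z` is `ω_F`-dual to `α`
(`ω₀(dF Z, dF w) = α(w)`, i.e. `Z` is the Liouville field of `α`), (OUT) `Z` points away from
`q` along the sphere `‖e_q x − c‖ = μ` (so `S_μ(q)` is of contact type and is the CONCAVE end of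
`(Σ ∖ p) ∖ B_μ(q)`, the CONVEX boundary of the q-side — the orientation clause of triage
r1-1/2/3); and (TEXT) a linear isometry `A` of `ℝ⁴` and a smooth `u : ℝ⁴ → ℝ` such that, for
`x` on the sphere, `θ := A⁻¹(μ⁻¹ (e_q x − c)) ∈ S³` and tangent `v` (`⟪De_q v, e_q x − c⟫ = 0`),
`α_x(v) = e^{u θ} · ½ ω₀(θ, A⁻¹(μ⁻¹ De_q v))` — i.e. the pull-back of `α|S_μ(q)` by the chart
parametrisation `θ ↦ e_q⁻¹(c + μ A θ)` is the positive multiple `e^{u} α₀` of the standard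
contact form of `S³ ⊂ ℂ²`: the characteristic contact structure of the inner sphere is the
standard TIGHT one, already in normal position.  Equivalent to SPC4(Σ): (⇐) for `Σ ≅ S⁴` take
`F` a diffeomorphism onto `ℝ⁴` standard near `p` and linear-unitary in the chart at `q` (Palais'
disc theorem), `α = F*λ₀`; (⇒) via this file.  Any tight contact-type inner sphere can be put in
T-ext form by reparametrising the jacket (`F ∘ Φ`, `Φ` an isotopy-supported diffeomorphism of the
shell), using Eliashberg's contact isotopy lemma (Geiges 2008, Lemma 4.11.1) — so this is the
card's K1 with Eliashberg absorbed.  Why it might fail: as a programme, no move on `F` is known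
that makes an inner sphere `ω_F`-convex from the q-side without making `F` injective; for an
exotic `Σ` every contact-type inner sphere of every jacket is overtwisted.
[cite: Geiges2008, Lemma/Definition 1.4.5, Lemma 4.11.1] [cite: Eliashberg1992, Thm 2.1.1]
[cite: Gromov1986, §2.2.2 (h-principle for open Diff-invariant relations), §3.4.2] -/
theorem stub_tightInnerSphere :
    ∀ (S : HomotopySphere 4) (p : S.carrier),
      ∃ q : S.carrier, q ≠ p ∧
      ∃ (F : punctured p → E4) (μ μ' δ : ℝ) (α : MForm (𝓡 4) (punctured p) ℝ 1)
        (Z : ∀ x : punctured p, TangentSpace (𝓡 4) x) (A : E4 ≃ₗᵢ[ℝ] E4) (u : E4 → ℝ),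
        -- jacket: immersion off `q`, standard (inverted chart) near `p`
        (∀ x : punctured p, x.1 ≠ q →
          ContMDiffAt (𝓡 4) 𝓘(ℝ, E4) ∞ F x ∧ Injective (mfderiv (𝓡 4) 𝓘(ℝ, E4) F x)) ∧
        AgreesWithInvertedChartNear p F ∧
        -- radii: the closed `μ'`-chart-ball about `q` lies in the chart and misses `p`
        0 < μ ∧ μ < μ' ∧ 0 < δ ∧
        Metric.closedBall (extChartAt (𝓡 4) q q) μ' ⊆ (extChartAt (𝓡 4) q).target ∧
        (∀ y ∈ Metric.closedBall (extChartAt (𝓡 4) q q) μ', (extChartAt (𝓡 4) q).symm y ≠ p) ∧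
        IsSmoothForm α ∧ ContDiff ℝ ∞ u ∧
        -- (PRIM) `dα = F*ω₀` on the shell
        (∀ x : punctured p, x.1 ∈ (chartAt E4 q).source →
          |‖extChartAt (𝓡 4) q x.1 - extChartAt (𝓡 4) q q‖ - μ| < δ →
          ∀ v w : TangentSpace (𝓡 4) x, mextDeriv α x ![v, w] =
            stdSymplecticForm (mfderiv (𝓡 4) 𝓘(ℝ, E4) F x v) (mfderiv (𝓡 4) 𝓘(ℝ, E4) F x w)) ∧
        -- (DUAL) `Z` is the `ω_F`-dual (Liouville) field of `α` on the shell
        (∀ x : punctured p, x.1 ∈ (chartAt E4 q).source →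
          |‖extChartAt (𝓡 4) q x.1 - extChartAt (𝓡 4) q q‖ - μ| < δ →
          ∀ w : TangentSpace (𝓡 4) x,
            stdSymplecticForm (mfderiv (𝓡 4) 𝓘(ℝ, E4) F x (Z x)) (mfderiv (𝓡 4) 𝓘(ℝ, E4) F x w) =
              α x ![w]) ∧
        -- (OUT) `Z` points away from `q` along the sphere `‖e_q x − c‖ = μ`
        (∀ x : punctured p, x.1 ∈ (chartAt E4 q).source →
          ‖extChartAt (𝓡 4) q x.1 - extChartAt (𝓡 4) q q‖ = μ →
          0 < @inner ℝ E4 _ (mfderiv (𝓡 4) 𝓘(ℝ, E4) (fun z : punctured p => extChartAt (𝓡 4) q z.1) x (Z x))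
            (extChartAt (𝓡 4) q x.1 - extChartAt (𝓡 4) q q)) ∧
        -- (TEXT) on the sphere, `α` is `e^u α₀` through the chart parametrisation `θ ↦ e_q⁻¹(c + μ A θ)`
        (∀ x : punctured p, x.1 ∈ (chartAt E4 q).source →
          ‖extChartAt (𝓡 4) q x.1 - extChartAt (𝓡 4) q q‖ = μ →
          ∀ v : TangentSpace (𝓡 4) x,
            @inner ℝ E4 _ (mfderiv (𝓡 4) 𝓘(ℝ, E4) (fun z : punctured p => extChartAt (𝓡 4) q z.1) x v)
              (extChartAt (𝓡 4) q x.1 - extChartAt (𝓡 4) q q) = 0 →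
            α x ![v] =
              Real.exp (u (A.symm (μ⁻¹ • (extChartAt (𝓡 4) q x.1 - extChartAt (𝓡 4) q q)))) *
                (1 / 2 * stdSymplecticForm
                  (A.symm (μ⁻¹ • (extChartAt (𝓡 4) q x.1 - extChartAt (𝓡 4) q q)))
                  (A.symm (μ⁻¹ • (mfderiv (𝓡 4) 𝓘(ℝ, E4)
                    (fun z : punctured p => extChartAt (𝓡 4) q z.1) x v : E4))))) := by
  sorry

/-- **Stub 2 — the LIOUVILLE COLLAR — PROVED (Theorems/SullivanDualTargetStubLiouvilleCollar.lean, p135853, worker W2 of lead c6: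
a 9-file formalisation of Geiges' Lemma 5.2.4 over the tree's flow library — Star p134474, Field p134478, Chart p134479, Forms p134569,
FlowOutCalc p134570, ChartForm p135079, FlowOut p135130, Euclid p135324).**  (Planner's description: M; Geiges 2008, Lemma 5.2.4, with the computation
`(θ ↦ ρ(θ) θ)*λ₀ = ρ² α₀` for `λ₀ = ½ ω₀(y, dy)`).**  In the situation of Stub 1 (jacket `F`
immersive off `q`; radii; smooth `α` with `dα = F*ω₀` and Liouville field `Z` on the shell, `Z`
outward along `S_μ(q)`; `α|S_μ(q) = e^{u} α₀` through `θ ↦ e_q⁻¹(c + μ A θ)`), there are a map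
`Ψ : Σ ∖ p → ℝ⁴` and a width `δ₁ > 0` such that on the shell `|‖e_q x − c‖ − μ| < δ₁`: `Ψ` is `C^∞`
with injective differential and injective (an embedding of the shell); `Ψ*ω₀ = F*ω₀`; on the
sphere `Ψ(e_q⁻¹(c + μ A θ)) = e^{u(θ)/2} θ` (so `Ψ(S_μ(q))` is the star-shaped hypersurface
`Y = {e^{u(θ)/2} θ}`); and `Ψ` carries the q-side `‖e_q x − c‖ < μ` exactly onto the inside of `Y`
(`‖Ψ x‖ < e^{u(Ψ x/‖Ψ x‖)/2}`).  Proof: `Ψ(φ^Z_t(e_q⁻¹(c + μ A θ))) := e^{t/2} e^{u(θ)/2} θ` —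
flow box of the transverse field `Z` (smooth: `ω_F` is non-degenerate on the shell) matched with
the radial Liouville flow of `ω₀`; `Ψ*λ₀ = α` because both `1`-forms vanish on the Liouville field,
satisfy `L_Z β = β` (so `β = e^t π*β|_{t=0}`) and agree at `t = 0` by (TEXT); hence
`Ψ*ω₀ = dα = F*ω₀`; sides from `t < 0 ⟺ q-side` (OUT).
[cite: Geiges2008, Lemma 5.2.4 and Lemma/Definition 1.4.5] -/
theorem stub_liouvilleCollar :
    ∀ (S : HomotopySphere 4) (p q : S.carrier) (F : punctured p → E4) (μ μ' δ : ℝ)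
      (α : MForm (𝓡 4) (punctured p) ℝ 1) (Z : ∀ x : punctured p, TangentSpace (𝓡 4) x)
      (A : E4 ≃ₗᵢ[ℝ] E4) (u : E4 → ℝ),
      q ≠ p →
      (∀ x : punctured p, x.1 ≠ q →
        ContMDiffAt (𝓡 4) 𝓘(ℝ, E4) ∞ F x ∧ Injective (mfderiv (𝓡 4) 𝓘(ℝ, E4) F x)) →
      0 < μ → μ < μ' → 0 < δ →
      Metric.closedBall (extChartAt (𝓡 4) q q) μ' ⊆ (extChartAt (𝓡 4) q).target →
      (∀ y ∈ Metric.closedBall (extChartAt (𝓡 4) q q) μ', (extChartAt (𝓡 4) q).symm y ≠ p) →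
      IsSmoothForm α → ContDiff ℝ ∞ u →
      (∀ x : punctured p, x.1 ∈ (chartAt E4 q).source →
        |‖extChartAt (𝓡 4) q x.1 - extChartAt (𝓡 4) q q‖ - μ| < δ →
        ∀ v w : TangentSpace (𝓡 4) x, mextDeriv α x ![v, w] =
          stdSymplecticForm (mfderiv (𝓡 4) 𝓘(ℝ, E4) F x v) (mfderiv (𝓡 4) 𝓘(ℝ, E4) F x w)) →
      (∀ x : punctured p, x.1 ∈ (chartAt E4 q).source →
        |‖extChartAt (𝓡 4) q x.1 - extChartAt (𝓡 4) q q‖ - μ| < δ →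
        ∀ w : TangentSpace (𝓡 4) x,
          stdSymplecticForm (mfderiv (𝓡 4) 𝓘(ℝ, E4) F x (Z x)) (mfderiv (𝓡 4) 𝓘(ℝ, E4) F x w) =
            α x ![w]) →
      (∀ x : punctured p, x.1 ∈ (chartAt E4 q).source →
        ‖extChartAt (𝓡 4) q x.1 - extChartAt (𝓡 4) q q‖ = μ →
        0 < @inner ℝ E4 _ (mfderiv (𝓡 4) 𝓘(ℝ, E4) (fun z : punctured p => extChartAt (𝓡 4) q z.1) x (Z x))
          (extChartAt (𝓡 4) q x.1 - extChartAt (𝓡 4) q q)) →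
      (∀ x : punctured p, x.1 ∈ (chartAt E4 q).source →
        ‖extChartAt (𝓡 4) q x.1 - extChartAt (𝓡 4) q q‖ = μ →
        ∀ v : TangentSpace (𝓡 4) x,
          @inner ℝ E4 _ (mfderiv (𝓡 4) 𝓘(ℝ, E4) (fun z : punctured p => extChartAt (𝓡 4) q z.1) x v)
            (extChartAt (𝓡 4) q x.1 - extChartAt (𝓡 4) q q) = 0 →
          α x ![v] =
            Real.exp (u (A.symm (μ⁻¹ • (extChartAt (𝓡 4) q x.1 - extChartAt (𝓡 4) q q)))) *
              (1 / 2 * stdSymplecticForm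
                (A.symm (μ⁻¹ • (extChartAt (𝓡 4) q x.1 - extChartAt (𝓡 4) q q)))
                (A.symm (μ⁻¹ • (mfderiv (𝓡 4) 𝓘(ℝ, E4)
                  (fun z : punctured p => extChartAt (𝓡 4) q z.1) x v : E4))))) →
      ∃ (Ψ : punctured p → E4) (δ₁ : ℝ), 0 < δ₁ ∧
        -- `Ψ` is an embedding of the `δ₁`-shell
        (∀ x : punctured p, x.1 ∈ (chartAt E4 q).source →
          |‖extChartAt (𝓡 4) q x.1 - extChartAt (𝓡 4) q q‖ - μ| < δ₁ →
          ContMDiffAt (𝓡 4) 𝓘(ℝ, E4) ∞ Ψ x ∧ Injective (mfderiv (𝓡 4) 𝓘(ℝ, E4) Ψ x)) ∧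
        (∀ x y : punctured p, x.1 ∈ (chartAt E4 q).source →
          |‖extChartAt (𝓡 4) q x.1 - extChartAt (𝓡 4) q q‖ - μ| < δ₁ →
          y.1 ∈ (chartAt E4 q).source →
          |‖extChartAt (𝓡 4) q y.1 - extChartAt (𝓡 4) q q‖ - μ| < δ₁ → Ψ x = Ψ y → x = y) ∧
        -- `Ψ*ω₀ = F*ω₀` on the shell
        (∀ x : punctured p, x.1 ∈ (chartAt E4 q).source →
          |‖extChartAt (𝓡 4) q x.1 - extChartAt (𝓡 4) q q‖ - μ| < δ₁ →
          ∀ v w : TangentSpace (𝓡 4) x,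
            stdSymplecticForm (mfderiv (𝓡 4) 𝓘(ℝ, E4) Ψ x v) (mfderiv (𝓡 4) 𝓘(ℝ, E4) Ψ x w) =
              stdSymplecticForm (mfderiv (𝓡 4) 𝓘(ℝ, E4) F x v) (mfderiv (𝓡 4) 𝓘(ℝ, E4) F x w)) ∧
        -- on the sphere `Ψ` is the star-shaped model `θ ↦ e^{u θ / 2} θ`
        (∀ x : punctured p, x.1 ∈ (chartAt E4 q).source →
          ‖extChartAt (𝓡 4) q x.1 - extChartAt (𝓡 4) q q‖ = μ →
          Ψ x = Real.exp (u (A.symm (μ⁻¹ • (extChartAt (𝓡 4) q x.1 - extChartAt (𝓡 4) q q))) / 2) •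
            A.symm (μ⁻¹ • (extChartAt (𝓡 4) q x.1 - extChartAt (𝓡 4) q q))) ∧
        -- sides: the q-side of the shell goes exactly to the inside of the star-shaped hypersurface
        (∀ x : punctured p, x.1 ∈ (chartAt E4 q).source →
          |‖extChartAt (𝓡 4) q x.1 - extChartAt (𝓡 4) q q‖ - μ| < δ₁ →
          (‖extChartAt (𝓡 4) q x.1 - extChartAt (𝓡 4) q q‖ < μ ↔
            ‖Ψ x‖ < Real.exp (u (‖Ψ x‖⁻¹ • Ψ x) / 2))) :=
  Summit.SmoothPoincare4.SmoothPoincare4.Theorems.Target.KaehlerJacket.stub_liouvilleCollar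

/-- **Stub 3 — BALL EXTENSION — PROVED (Theorems/SullivanDualTargetStubBallExtension.lean, p133004, lead c6: via an
IMMERSION of the chart ball, `Θ = M₀ ∘ κ' ∘ g ∘ e_q`, and form gluing — no collar uniqueness; helpers p132250 p132272
p132336 p132421 p132477 p132572 p132634).**  (Planner's description: M–L; radial
extension of a boundary identification `C¹`-close to the identity, Geiges 2008 Lemma 1.7.2 /
Cerf's Lemme 2 in its ELEMENTARY isotopic-to-identity case; piecewise forms.)  Given the jacket
`F` (immersive off `q`), the radii, a smooth `u`, and the collar `Ψ` of Stub 2 on a `δ₁`-shell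
(embedding, `Ψ*ω₀ = F*ω₀`, the star-shaped model on the sphere, sides), there is a `2`-form `sf`
on `Σ ∖ p` which is smooth, closed, pointwise non-degenerate and EQUAL TO `F*ω₀` at every point
off the closed chart-ball `B̄_μ(q) = {x ∈ chart source, ‖e_q x − c‖ ≤ μ}`.  Proof: the boundary
identification `S_μ(q) → Y`, read through `θ ↦ e_q⁻¹(c + μ A θ)` and the radial projection of `Y`,
is the LINEAR map `A⁻¹`, which extends over the ball: the radial model
`Θ₀(e_q⁻¹(c + r A θ)) = (r/μ) e^{χ(r) u(θ)/2} θ` (`χ` a slow cut-off, `= 0` near `r = 0`, `= 1` near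
`r = μ`, with `∂_r` of the radius positive) is a diffeomorphism of `B̄_μ(q)` onto the closed
star-shaped domain, linear near `q`; `Θ₀` and `Ψ` are two collars of `Y` on the same side
(sides clause), so by uniqueness of collars up to isotopy (Hirsch 1976, Thm 4.6.3; the isotopy is
swept out as in `h(x) = ‖x‖ F_{‖x‖}(x/‖x‖)`) a diffeomorphism `κ` of the domain supported near `Y`
gives `Θ := κ ∘ Θ₀ = Ψ` on an inner collar; set `sf := Θ*ω₀` on `B̄_μ(q)`, `:= F*ω₀` elsewhere —
the two agree with `Ψ*ω₀` on an open two-sided collar of `S_μ(q)`, so `sf` is smooth and closed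
(naturality of `d`, `dω₀ = 0`) and non-degenerate (`dΘ`, `dF` injective; `q ∈ B̄_μ(q)`, so `F` is
only used where it is immersive).
[cite: Geiges2008, Lemma 1.7.2] [cite: Hirsch1976, Thm 4.6.3 (uniqueness of collars)] -/
theorem stub_ballExtension :
    ∀ (S : HomotopySphere 4) (p q : S.carrier) (F : punctured p → E4) (μ μ' : ℝ)
      (A : E4 ≃ₗᵢ[ℝ] E4) (u : E4 → ℝ) (Ψ : punctured p → E4) (δ₁ : ℝ),
      q ≠ p →
      (∀ x : punctured p, x.1 ≠ q →
        ContMDiffAt (𝓡 4) 𝓘(ℝ, E4) ∞ F x ∧ Injective (mfderiv (𝓡 4) 𝓘(ℝ, E4) F x)) →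
      0 < μ → μ < μ' →
      Metric.closedBall (extChartAt (𝓡 4) q q) μ' ⊆ (extChartAt (𝓡 4) q).target →
      (∀ y ∈ Metric.closedBall (extChartAt (𝓡 4) q q) μ', (extChartAt (𝓡 4) q).symm y ≠ p) →
      ContDiff ℝ ∞ u → 0 < δ₁ →
      (∀ x : punctured p, x.1 ∈ (chartAt E4 q).source →
        |‖extChartAt (𝓡 4) q x.1 - extChartAt (𝓡 4) q q‖ - μ| < δ₁ →
        ContMDiffAt (𝓡 4) 𝓘(ℝ, E4) ∞ Ψ x ∧ Injective (mfderiv (𝓡 4) 𝓘(ℝ, E4) Ψ x)) →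
      (∀ x y : punctured p, x.1 ∈ (chartAt E4 q).source →
        |‖extChartAt (𝓡 4) q x.1 - extChartAt (𝓡 4) q q‖ - μ| < δ₁ →
        y.1 ∈ (chartAt E4 q).source →
        |‖extChartAt (𝓡 4) q y.1 - extChartAt (𝓡 4) q q‖ - μ| < δ₁ → Ψ x = Ψ y → x = y) →
      (∀ x : punctured p, x.1 ∈ (chartAt E4 q).source →
        |‖extChartAt (𝓡 4) q x.1 - extChartAt (𝓡 4) q q‖ - μ| < δ₁ →
        ∀ v w : TangentSpace (𝓡 4) x,
          stdSymplecticForm (mfderiv (𝓡 4) 𝓘(ℝ, E4) Ψ x v) (mfderiv (𝓡 4) 𝓘(ℝ, E4) Ψ x w) =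
            stdSymplecticForm (mfderiv (𝓡 4) 𝓘(ℝ, E4) F x v) (mfderiv (𝓡 4) 𝓘(ℝ, E4) F x w)) →
      (∀ x : punctured p, x.1 ∈ (chartAt E4 q).source →
        ‖extChartAt (𝓡 4) q x.1 - extChartAt (𝓡 4) q q‖ = μ →
        Ψ x = Real.exp (u (A.symm (μ⁻¹ • (extChartAt (𝓡 4) q x.1 - extChartAt (𝓡 4) q q))) / 2) •
          A.symm (μ⁻¹ • (extChartAt (𝓡 4) q x.1 - extChartAt (𝓡 4) q q))) →
      (∀ x : punctured p, x.1 ∈ (chartAt E4 q).source →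
        |‖extChartAt (𝓡 4) q x.1 - extChartAt (𝓡 4) q q‖ - μ| < δ₁ →
        (‖extChartAt (𝓡 4) q x.1 - extChartAt (𝓡 4) q q‖ < μ ↔
          ‖Ψ x‖ < Real.exp (u (‖Ψ x‖⁻¹ • Ψ x) / 2))) →
      ∃ sf : MForm (𝓡 4) (punctured p) ℝ 2,
        IsSmoothForm sf ∧ IsClosedForm sf ∧
        (∀ (x : punctured p) (v : TangentSpace (𝓡 4) x), v ≠ 0 → ∃ w, sf x ![v, w] ≠ 0) ∧
        (∀ x : punctured p,
          ¬ (x.1 ∈ (chartAt E4 q).source ∧ ‖extChartAt (𝓡 4) q x.1 - extChartAt (𝓡 4) q q‖ ≤ μ) →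
          ∀ v w : TangentSpace (𝓡 4) x, sf x ![v, w] =
            stdSymplecticForm (mfderiv (𝓡 4) 𝓘(ℝ, E4) F x v) (mfderiv (𝓡 4) 𝓘(ℝ, E4) F x w)) :=
  Summit.SmoothPoincare4.SmoothPoincare4.Theorems.Target.KaehlerJacket.stub_ballExtension

/-- **Stub 4 — STANDARD END — PROVED (Theorems/SullivanDualTargetStubStandardEnd.lean, p132182, lead c6 wave 1).**  If `F`
agrees with the inverted recentred chart `ι ∘ (e_p − e_p p)` on a punctured chart-ball at `p`, the
closed `μ`-chart-ball about `q` lies in its chart and misses `p`, and `sf` is a smooth closed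
non-degenerate `2`-form on `Σ ∖ p` equal to `F*ω₀` off that closed ball, then `sf` is symplectic
and standard near `p` (`IsSymplecticStandardNearPoint p ε sf`) for some `ε`: the image of the
closed ball under `e_q⁻¹` is compact and misses `p`, so a small punctured chart-ball at `p` avoids
it; there `sf = F*ω₀` and `F = ι ∘ (e_p − e_p p)` near each point, whence
`sf_x(v, w) = ω₀(Dι De_p v, Dι De_p w) = invertedStdForm (e_p x − e_p p) (De_p v) (De_p w)` by the
chain rule (`ι` is differentiable off `0`, and `e_p x ≠ e_p p` for `x ≠ p` in the chart source).
[cite: Gromov1985, §0.3.C] [cite: McDuffSalamon2012, §9.4] -/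
theorem stub_standardEnd :
    ∀ (S : HomotopySphere 4) (p q : S.carrier) (F : punctured p → E4) (μ : ℝ)
      (sf : MForm (𝓡 4) (punctured p) ℝ 2),
      AgreesWithInvertedChartNear p F →
      Metric.closedBall (extChartAt (𝓡 4) q q) μ ⊆ (extChartAt (𝓡 4) q).target →
      (∀ y ∈ Metric.closedBall (extChartAt (𝓡 4) q q) μ, (extChartAt (𝓡 4) q).symm y ≠ p) →
      IsSmoothForm sf → IsClosedForm sf →
      (∀ (x : punctured p) (v : TangentSpace (𝓡 4) x), v ≠ 0 → ∃ w, sf x ![v, w] ≠ 0) →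
      (∀ x : punctured p,
        ¬ (x.1 ∈ (chartAt E4 q).source ∧ ‖extChartAt (𝓡 4) q x.1 - extChartAt (𝓡 4) q q‖ ≤ μ) →
        ∀ v w : TangentSpace (𝓡 4) x, sf x ![v, w] =
          stdSymplecticForm (mfderiv (𝓡 4) 𝓘(ℝ, E4) F x v) (mfderiv (𝓡 4) 𝓘(ℝ, E4) F x w)) →
      ∃ ε : ℝ, IsSymplecticStandardNearPoint p ε sf :=
  Summit.SmoothPoincare4.SmoothPoincare4.Theorems.Target.KaehlerJacket.stub_standardEnd

/-! ## Composition: the crux `Target` from the four stubs (sorry-free) -/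

/-- **`Target` of route SullivanDual from the Kähler jacket.**  Per `(Σ, p)`: the apex
(`stub_tightInnerSphere`) gives `q, F, μ, μ', δ, α, Z, A, u`; the Liouville collar
(`stub_liouvilleCollar`) gives the symplectic embedding `Ψ` of a shell onto a collar of a
star-shaped hypersurface; the ball extension (`stub_ballExtension`) caps `q` and returns a smooth
closed non-degenerate `sf` equal to `F*ω₀` off the cap; the standard-end stub
(`stub_standardEnd`) makes it `IsSymplecticStandardNearPoint p ε sf`; the landed door
`SullivanDual.target_of_sympcapThesisV2` (p119400) turns one such form per `(Σ, p)` into `Target`.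
[cite: Sullivan1976, Thm. I.7] [cite: Gromov1985, §0.3.C] -/
theorem Target_of : Summit.SmoothPoincare4.SmoothPoincare4.Theses.SullivanDual.Target := by
  refine Summit.SmoothPoincare4.SmoothPoincare4.Theorems.SullivanDual.target_of_sympcapThesisV2 ?_
  intro S p
  obtain ⟨q, hq, F, μ, μ', δ, α, Z, A, u, hF, hFp, hμ, hμμ', hδ, hball, havoid, hα, hu,
    hprim, hdual, hout, htext⟩ := stub_tightInnerSphere S p
  obtain ⟨Ψ, δ₁, hδ₁, hΨemb, hΨinj, hΨsymp, hΨsphere, hΨsides⟩ :=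
    stub_liouvilleCollar S p q F μ μ' δ α Z A u hq hF hμ hμμ' hδ hball havoid hα hu
      hprim hdual hout htext
  obtain ⟨sf, hs, hc, hnd, hoff⟩ :=
    stub_ballExtension S p q F μ μ' A u Ψ δ₁ hq hF hμ hμμ' hball havoid hu hδ₁
      hΨemb hΨinj hΨsymp hΨsphere hΨsides
  obtain ⟨ε, hε⟩ :=
    stub_standardEnd S p q F μ sf hFp
      ((Metric.closedBall_subset_closedBall hμμ'.le).trans hball)
      (fun y hy => havoid y (Metric.closedBall_subset_closedBall hμμ'.le hy)) hs hc hnd hoff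
  exact ⟨ε, sf, hε⟩

end Summit.SmoothPoincare4.SmoothPoincare4.Cruxes.Target.KaehlerJacket

end
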